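import Literature.Topology.FourManifolds.LatticeFormsSplitting
import Literature.Topology.FourManifolds.LatticeFormsUnitBasis
import Literature.Topology.FourManifolds.LatticeFormsProofs
import Literature.Topology.FourManifolds.LatticeFormsDefinite
import HarnessLib

/-!
# The even sublattice of `I₊ ⊕ I₋ ⊕ F` and of `U ⊕ F` (Serre, *A Course in Arithmetic*, Ch. V §3.5, Lemma 6)

Trunk T-4MAN; part of the decomposition of the named fact
`LinearMap.BilinForm.equivalent_of_isIndefinite` (Serre, Ch. V §2.2 Thm 6). This file sets up the
lattices of Serre's Lemma 6 ("`F₁, F₂` of type II and `I₊ ⊕ I₋ ⊕ F₁ ≃ I₊ ⊕ I₋ ⊕ F₂` imply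
`U ⊕ F₁ ≃ U ⊕ F₂`") integrally, i.e. without passing to `E ⊗ ℚ`.

With `W = I₊ ⊕ I₋` (Gram matrix `diag(1, -1)` on `ℤ²`), `U` the hyperbolic plane
(`Literature.Topology.FourManifolds.hyperbolicForm`, Gram `!![0,1;1,0]`) and `F` even, Serre's even
sublattice `E⁰ = W⁰ ⊕ F` of `E = W ⊕ F` (the `x` with `x.x` even; `W⁰ = {(x₁, x₂) : x₁ ≡ x₂ (2)}`)
is, abstractly, the lattice `Λ ⊕ F` with `Λ` of Gram matrix `!![0,2;2,0]` (basis `(1,1), (1,-1)`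
of `W⁰`); and `Λ ⊕ F` is *also* the sublattice `2ℤ × ℤ × F` of `U ⊕ F` (basis `2e₀, e₁`). We
realise both inclusions as explicit injective isometric maps of `ℤ² × M` into itself,
* `κ : Λ ⊕ F → W ⊕ F`, `((p, q), f) ↦ ((p + q, p − q), f)`, with image `E⁰ = {x.x even}`
  (`mem_range_kappa_iff`), and
* `ι : Λ ⊕ F → U ⊕ F`, `((p, q), f) ↦ ((2p, q), f)`,
both of exponent `2` (`2x` lies in the image). Consequences proved here:
* `signature (U ⊕ F) = signature (I₊ ⊕ I₋ ⊕ F)` (`signature_hyperbolicForm_prod_eq`), by the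
  finite-exponent invariance of `LatticeFormsUnitBasis.lean` — Serre reads this off
  `τ(U) = 0 = τ(I₊ ⊕ I₋)` and additivity (Ch. V §1.3.7, §1.4);
* an isometry `W ⊕ F₁ ≅ W ⊕ F₂` carries `E₁⁰` onto `E₂⁰` and hence induces `Λ ⊕ F₁ ≅ Λ ⊕ F₂`
  (`equivalent_twoHyperbolic_prod_of_equivalent_diag_prod`; the abstract transfer step is
  `equivalent_of_forall_mem_range_iff`).
The passage from `Λ ⊕ Fᵢ` back up to `U ⊕ Fᵢ` (Serre's "three lattices between `E⁰` and its
dual") is the sequel file `LatticeFormsIndefiniteEven.lean`.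

`ℤ`-lattices carry the canonical structure `AddCommGroup.toIntModule` (only `[AddCommGroup M]` is
assumed), see `LatticeFormsOrthoSum.lean`.

## Sources

* J.-P. Serre, *A Course in Arithmetic* (GTM 7, Springer 1973), Ch. V §3.5 Lemma 6 (the
  lattices `E⁰ ⊂ E ⊂ E⁺`, `W⁰`, `W'`, `W''`), §1.3.7 and §1.4.1–1.4.2 (invariants of `I±`, `U`).
  [Serre1973]
* J. Milnor, D. Husemoller, *Symmetric bilinear forms* (Springer 1973), Ch. II §5 (even/odd
  correspondence). [MilnorHusemoller1973]
-/

open Module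
open LinearMap (BilinForm)
open scoped Matrix

namespace LinearMap.BilinForm

/-! ### Two abstract lemmas -/

section CommRing

variable {R : Type*} [CommRing R] {L₁ L₂ W₁ W₂ : Type*} [AddCommGroup L₁] [Module R L₁]
  [AddCommGroup L₂] [Module R L₂] [AddCommGroup W₁] [Module R W₁] [AddCommGroup W₂] [Module R W₂]
  {Λ₁ : BilinForm R L₁} {Λ₂ : BilinForm R L₂} {Ω₁ : BilinForm R W₁} {Ω₂ : BilinForm R W₂}

/-- **Transfer of an isometry to sublattices.** Let `κᵢ : Lᵢ → Wᵢ` be injective isometric maps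
(`Ωᵢ (κᵢ l) (κᵢ l') = Λᵢ l l'`) and `Φ : W₁ ≅ W₂` an isometry which carries the image of `κ₁`
exactly onto the image of `κ₂`. Then `Λ₁ ≅ Λ₂` (by `κ₂⁻¹ ∘ Φ ∘ κ₁`). This is the step "`f`
carries `E₁⁰` onto `E₂⁰`" of Serre, *A Course in Arithmetic*, Ch. V §3.5, proof of Lemma 6.
[cite: Serre1973, Ch. V §3.5 Lemma 6] -/
theorem equivalent_of_forall_mem_range_iff (κ₁ : L₁ →ₗ[R] W₁) (κ₂ : L₂ →ₗ[R] W₂)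
    (hκ₂ : Function.Injective κ₂)
    (h₁ : ∀ l l', Ω₁ (κ₁ l) (κ₁ l') = Λ₁ l l') (h₂ : ∀ l l', Ω₂ (κ₂ l) (κ₂ l') = Λ₂ l l')
    (Φ : Ω₁.IsometryEquiv Ω₂)
    (hr : ∀ w, w ∈ LinearMap.range κ₁ ↔ Φ w ∈ LinearMap.range κ₂)
    (hΛ₁ : ∀ l, (∀ l', Λ₁ l l' = 0) → l = 0) : Λ₁.Equivalent Λ₂ := by
  -- `ψ₀ = κ₂⁻¹ ∘ Φ ∘ κ₁`
  let g : L₁ →ₗ[R] LinearMap.range κ₂ :=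
    LinearMap.codRestrict (LinearMap.range κ₂) ((Φ : W₁ ≃ₗ[R] W₂).toLinearMap ∘ₗ κ₁)
      fun l => (hr (κ₁ l)).mp (LinearMap.mem_range_self κ₁ l)
  let ψ₀ : L₁ →ₗ[R] L₂ := (LinearEquiv.ofInjective κ₂ hκ₂).symm.toLinearMap ∘ₗ g
  have hψ₀ : ∀ l, κ₂ (ψ₀ l) = Φ (κ₁ l) := fun l => by
    have : ((LinearEquiv.ofInjective κ₂ hκ₂) (ψ₀ l) : W₂) = (g l : W₂) := by
      simp only [ψ₀, LinearMap.coe_comp, LinearEquiv.coe_coe, Function.comp_apply,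
        LinearEquiv.apply_symm_apply]
    rw [LinearEquiv.ofInjective_apply] at this
    rw [this]
    rfl
  have hiso : ∀ l l', Λ₂ (ψ₀ l) (ψ₀ l') = Λ₁ l l' := fun l l' => by
    rw [← h₂, hψ₀, hψ₀, Φ.map_app, h₁]
  have hinj : Function.Injective ψ₀ := fun l l' hll' => by
    have h0 : ∀ m, Λ₁ (l - l') m = 0 := fun m => by
      rw [← hiso, map_sub, map_sub, LinearMap.sub_apply, hll', sub_self]
    exact sub_eq_zero.mp (hΛ₁ _ h0)
  have hΦ : ∀ w, Φ (Φ.symm w) = w := fun w => (Φ : W₁ ≃ₗ[R] W₂).apply_symm_apply w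
  have hsurj : Function.Surjective ψ₀ := fun l₂ => by
    have hmem : Φ.symm (κ₂ l₂) ∈ LinearMap.range κ₁ := by
      rw [hr, hΦ]
      exact LinearMap.mem_range_self κ₂ l₂
    obtain ⟨l₁, hl₁⟩ := LinearMap.mem_range.mp hmem
    refine ⟨l₁, hκ₂ ?_⟩
    rw [hψ₀, hl₁, hΦ]
  exact ⟨{ LinearEquiv.ofBijective ψ₀ ⟨hinj, hsurj⟩ with
    map_app' := fun l l' => by
      show Λ₂ (LinearEquiv.ofBijective ψ₀ ⟨hinj, hsurj⟩ l)
        (LinearEquiv.ofBijective ψ₀ ⟨hinj, hsurj⟩ l') = Λ₁ l l'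
      rw [LinearEquiv.ofBijective_apply, LinearEquiv.ofBijective_apply, hiso] }⟩

end CommRing

/-- A torsion-free `ℤ`-module has no zero smul-divisors (bridge to the older Mathlib class, which
`sigPos_eq_of_injective_of_smul_mem_range` is stated with). [folklore] -/
theorem noZeroSMulDivisors_int_of_isTorsionFree {V : Type*} [AddCommGroup V]
    [Module.IsTorsionFree ℤ V] : NoZeroSMulDivisors ℤ V := by
  refine ⟨fun {c x} h => ?_⟩
  by_cases hc : c = 0
  · exact Or.inl hc
  · right
    have hreg : Function.Injective fun y : V => c • y := (IsRegular.of_ne_zero hc).isSMulRegular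
    exact hreg (by simp only [h, smul_zero])

end LinearMap.BilinForm

/-! ### The lattices `Λ ⊕ F ⊂ U ⊕ F` and `Λ ⊕ F ≅ E⁰ ⊂ I₊ ⊕ I₋ ⊕ F` -/

namespace Literature.Topology.FourManifolds

open LinearMap.BilinForm

/-- Evaluation of `I₊ ⊕ I₋` on `ℤ²` (Gram matrix `diag(1, -1)`): `v₀ w₀ − v₁ w₁`.
Serre, *A Course in Arithmetic*, Ch. V §1.4.1. [cite: Serre1973, Ch. V §1.4.1] -/
theorem toBilin'_diagonal_one_neg_one_apply (v w : Fin 2 → ℤ) :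
    Matrix.toBilin' (Matrix.diagonal ![(1 : ℤ), -1]) v w = v 0 * w 0 - v 1 * w 1 := by
  simp [Matrix.toBilin'_apply', Matrix.mulVec, dotProduct, Fin.sum_univ_two, Matrix.diagonal]
  ring

/-- Evaluation of the doubled hyperbolic plane `Λ` (Gram matrix `!![0,2;2,0]`, the even sublattice
`W⁰` of `I₊ ⊕ I₋` in the basis `(1,1), (1,-1)`, equivalently `2ℤ e₀ ⊕ ℤ e₁ ⊂ U`):
`2 (v₀ w₁ + v₁ w₀)`. Serre, *A Course in Arithmetic*, Ch. V §3.5 (the lattice `W⁰`).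
[cite: Serre1973, Ch. V §3.5 Lemma 6] -/
theorem toBilin'_twoHyperbolic_apply (v w : Fin 2 → ℤ) :
    Matrix.toBilin' !![(0 : ℤ), 2; 2, 0] v w = 2 * (v 0 * w 1 + v 1 * w 0) := by
  simp [Matrix.toBilin'_apply', Matrix.mulVec, dotProduct, Fin.sum_univ_two]
  ring

/-- `I₊ ⊕ I₋` is symmetric. [cite: Serre1973, Ch. V §1.4.1] -/
theorem isSymm_toBilin'_diagonal_one_neg_one :
    (Matrix.toBilin' (Matrix.diagonal ![(1 : ℤ), -1])).IsSymm :=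
  ⟨fun v w => by rw [toBilin'_diagonal_one_neg_one_apply, toBilin'_diagonal_one_neg_one_apply]; ring⟩

/-- `Λ` is symmetric. [folklore] -/
theorem isSymm_toBilin'_twoHyperbolic : (Matrix.toBilin' !![(0 : ℤ), 2; 2, 0]).IsSymm :=
  ⟨fun v w => by rw [toBilin'_twoHyperbolic_apply, toBilin'_twoHyperbolic_apply]; ring⟩

/-- `I₊ ⊕ I₋` is unimodular (`det diag(1,-1) = -1`). Serre, *A Course in Arithmetic*, Ch. V
§1.4.1 (`d = (-1)^t`). [cite: Serre1973, Ch. V §1.4.1] -/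
theorem isUnimodular_toBilin'_diagonal_one_neg_one :
    (Matrix.toBilin' (Matrix.diagonal ![(1 : ℤ), -1])).IsUnimodular := by
  rw [isUnimodular_iff_isUnit_det_holds _ (Pi.basisFun ℤ (Fin 2)),
    LinearMap.BilinForm.toMatrix_basisFun, LinearMap.BilinForm.toMatrix'_toBilin',
    Matrix.det_diagonal]
  simp [Fin.prod_univ_two]

/-- `I₊ ⊕ I₋ ⊕ F` is indefinite: `e₁.e₁ = -1 < 0 < 1 = e₀.e₀`. Serre, *A Course in Arithmetic*,
Ch. V §1.3.2. [cite: Serre1973, Ch. V §1.3.2] -/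
theorem isIndefinite_toBilin'_diagonal_one_neg_one_prod {M : Type*} [AddCommGroup M]
    (F : BilinForm ℤ M) : ((Matrix.toBilin' (Matrix.diagonal ![(1 : ℤ), -1])).prod F).IsIndefinite :=
  isIndefinite_of_apply_self_neg_of_pos (x := (Pi.single 1 1, 0)) (y := (Pi.single 0 1, 0))
    (by simp) (by simp)

section Sublattices

variable {M : Type*} [AddCommGroup M] (F : BilinForm ℤ M)

/-- Equality of a pair vector with a given vector, componentwise. [folklore] -/
theorem vec2_eq_iff (a b : ℤ) (v : Fin 2 → ℤ) : ![a, b] = v ↔ a = v 0 ∧ b = v 1 := by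
  constructor
  · rintro rfl
    simp
  · rintro ⟨h0, h1⟩
    ext i
    fin_cases i <;> simp [h0, h1]

/-- The matrix of `ι` on `ℤ²`: `(p, q) ↦ (2p, q)`. [folklore] -/
theorem mulVec_iota (v : Fin 2 → ℤ) : !![(2 : ℤ), 0; 0, 1] *ᵥ v = ![2 * v 0, v 1] := by
  ext i
  fin_cases i <;> simp [Matrix.mulVec, dotProduct, Fin.sum_univ_two]

/-- The matrix of `κ` on `ℤ²`: `(p, q) ↦ (p + q, p − q)`. [folklore] -/
theorem mulVec_kappa (v : Fin 2 → ℤ) : !![(1 : ℤ), 1; 1, -1] *ᵥ v = ![v 0 + v 1, v 0 - v 1] := by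
  ext i
  fin_cases i <;> simp [Matrix.mulVec, dotProduct, Fin.sum_univ_two, sub_eq_add_neg]

/-- **`ι` is isometric**: `((2p, q), f) ↦` into `U ⊕ F` pulls `U ⊕ F` back to `Λ ⊕ F`
(`2ℤ e₀ ⊕ ℤ e₁ ⊂ U` has Gram matrix `!![0,2;2,0]`). [cite: Serre1973, Ch. V §3.5 Lemma 6] -/
theorem hyperbolicForm_prod_iota_apply (l l' : (Fin 2 → ℤ) × M) :
    (hyperbolicForm.prod F)
        (LinearMap.prodMap (Matrix.mulVecLin !![(2 : ℤ), 0; 0, 1]) LinearMap.id l)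
        (LinearMap.prodMap (Matrix.mulVecLin !![(2 : ℤ), 0; 0, 1]) LinearMap.id l') =
      ((Matrix.toBilin' !![(0 : ℤ), 2; 2, 0]).prod F) l l' := by
  simp only [prod_apply, LinearMap.prodMap_apply, Matrix.mulVecLin_apply, mulVec_iota,
    LinearMap.id_apply, hyperbolicForm_apply, toBilin'_twoHyperbolic_apply, Matrix.cons_val_zero,
    Matrix.cons_val_one]
  ring

/-- **`κ` is isometric**: `((p + q, p − q), f) ↦` into `I₊ ⊕ I₋ ⊕ F` pulls it back to `Λ ⊕ F`
(`(p+q)² − (p−q)² = 4pq`; Serre's basis `a = (1,1)`, `b = (1,-1)` of `W⁰` up to the factor `½`).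
[cite: Serre1973, Ch. V §3.5 Lemma 6] -/
theorem diag_prod_kappa_apply (l l' : (Fin 2 → ℤ) × M) :
    ((Matrix.toBilin' (Matrix.diagonal ![(1 : ℤ), -1])).prod F)
        (LinearMap.prodMap (Matrix.mulVecLin !![(1 : ℤ), 1; 1, -1]) LinearMap.id l)
        (LinearMap.prodMap (Matrix.mulVecLin !![(1 : ℤ), 1; 1, -1]) LinearMap.id l') =
      ((Matrix.toBilin' !![(0 : ℤ), 2; 2, 0]).prod F) l l' := by
  simp only [prod_apply, LinearMap.prodMap_apply, Matrix.mulVecLin_apply, mulVec_kappa,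
    LinearMap.id_apply, toBilin'_diagonal_one_neg_one_apply, toBilin'_twoHyperbolic_apply,
    Matrix.cons_val_zero, Matrix.cons_val_one]
  ring

/-- `ι` is injective. [folklore] -/
theorem injective_iota :
    Function.Injective
      (LinearMap.prodMap (Matrix.mulVecLin !![(2 : ℤ), 0; 0, 1]) (LinearMap.id (M := M) (R := ℤ))) := by
  intro l l' h
  simp only [LinearMap.prodMap_apply, Matrix.mulVecLin_apply, mulVec_iota, LinearMap.id_apply,
    Prod.mk.injEq] at h
  obtain ⟨h1, h2⟩ := h
  have h0 := congr_fun h1 0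
  have h1' := congr_fun h1 1
  simp only [Matrix.cons_val_zero, Matrix.cons_val_one] at h0 h1'
  refine Prod.ext (funext fun i => ?_) h2
  fin_cases i
  · simpa using (by omega : l.1 0 = l'.1 0)
  · simpa using h1'

/-- `κ` is injective. [folklore] -/
theorem injective_kappa :
    Function.Injective
      (LinearMap.prodMap (Matrix.mulVecLin !![(1 : ℤ), 1; 1, -1]) (LinearMap.id (M := M) (R := ℤ))) := by
  intro l l' h
  simp only [LinearMap.prodMap_apply, Matrix.mulVecLin_apply, mulVec_kappa, LinearMap.id_apply,
    Prod.mk.injEq] at h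
  obtain ⟨h1, h2⟩ := h
  have h0 := congr_fun h1 0
  have h1' := congr_fun h1 1
  simp only [Matrix.cons_val_zero, Matrix.cons_val_one] at h0 h1'
  refine Prod.ext (funext fun i => ?_) h2
  fin_cases i
  · simpa using (by omega : l.1 0 = l'.1 0)
  · simpa using (by omega : l.1 1 = l'.1 1)

/-- `ι` has exponent `2`: `2x ∈ ι(Λ ⊕ F)` for every `x ∈ U ⊕ F`. [folklore] -/
theorem two_smul_mem_range_iota (x : (Fin 2 → ℤ) × M) :
    (2 : ℤ) • x ∈ LinearMap.range
      (LinearMap.prodMap (Matrix.mulVecLin !![(2 : ℤ), 0; 0, 1]) (LinearMap.id (M := M) (R := ℤ))) := by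
  refine ⟨(![x.1 0, 2 * x.1 1], (2 : ℤ) • x.2), ?_⟩
  simp only [LinearMap.prodMap_apply, Matrix.mulVecLin_apply, mulVec_iota, LinearMap.id_apply,
    Matrix.cons_val_zero, Matrix.cons_val_one]
  refine Prod.ext ((vec2_eq_iff _ _ _).mpr ⟨?_, ?_⟩) rfl <;> simp

/-- `κ` has exponent `2`: `2x ∈ κ(Λ ⊕ F)` for every `x ∈ I₊ ⊕ I₋ ⊕ F` ("`2x₁ ∈ ℤ, 2x₂ ∈ ℤ`").
[folklore] -/
theorem two_smul_mem_range_kappa (x : (Fin 2 → ℤ) × M) :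
    (2 : ℤ) • x ∈ LinearMap.range
      (LinearMap.prodMap (Matrix.mulVecLin !![(1 : ℤ), 1; 1, -1]) (LinearMap.id (M := M) (R := ℤ))) := by
  refine ⟨(![x.1 0 + x.1 1, x.1 0 - x.1 1], (2 : ℤ) • x.2), ?_⟩
  simp only [LinearMap.prodMap_apply, Matrix.mulVecLin_apply, mulVec_kappa, LinearMap.id_apply,
    Matrix.cons_val_zero, Matrix.cons_val_one]
  refine Prod.ext ((vec2_eq_iff _ _ _).mpr ⟨?_, ?_⟩) rfl
  · simp only [Prod.smul_fst, Pi.smul_apply, smul_eq_mul]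
    ring
  · simp only [Prod.smul_fst, Pi.smul_apply, smul_eq_mul]
    ring

/-- The image of `ι` is `2ℤ × ℤ × F ⊂ U ⊕ F`: `x ∈ ι(Λ ⊕ F)` iff its `e₀`-coordinate is even.
[folklore] -/
theorem mem_range_iota_iff (x : (Fin 2 → ℤ) × M) :
    x ∈ LinearMap.range
        (LinearMap.prodMap (Matrix.mulVecLin !![(2 : ℤ), 0; 0, 1]) (LinearMap.id (M := M) (R := ℤ))) ↔
      Even (x.1 0) := by
  constructor
  · rintro ⟨l, rfl⟩
    simp only [LinearMap.prodMap_apply, Matrix.mulVecLin_apply, mulVec_iota, Matrix.cons_val_zero]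
    exact even_two_mul _
  · rintro ⟨p, hp⟩
    refine ⟨(![p, x.1 1], x.2), ?_⟩
    simp only [LinearMap.prodMap_apply, Matrix.mulVecLin_apply, mulVec_iota, LinearMap.id_apply,
      Matrix.cons_val_zero, Matrix.cons_val_one]
    exact Prod.ext ((vec2_eq_iff _ _ _).mpr ⟨by omega, rfl⟩) rfl

/-- **The image of `κ` is Serre's even sublattice `E⁰`**: for `F` of type II, `x ∈ I₊ ⊕ I₋ ⊕ F`
lies in `κ(Λ ⊕ F)` iff `x.x` is even — "`E⁰ = W⁰ ⊕ F` where `W⁰` is the set of `(x₁, x₂)` with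
`x₁ ≡ x₂ (mod 2)`" (Serre, *A Course in Arithmetic*, Ch. V §3.5, proof of Lemma 6).
[cite: Serre1973, Ch. V §3.5 Lemma 6] -/
theorem mem_range_kappa_iff (hF : F.IsEven) (x : (Fin 2 → ℤ) × M) :
    x ∈ LinearMap.range
        (LinearMap.prodMap (Matrix.mulVecLin !![(1 : ℤ), 1; 1, -1]) (LinearMap.id (M := M) (R := ℤ))) ↔
      Even (((Matrix.toBilin' (Matrix.diagonal ![(1 : ℤ), -1])).prod F) x x) := by
  constructor
  · rintro ⟨l, rfl⟩
    rw [diag_prod_kappa_apply, prod_apply, toBilin'_twoHyperbolic_apply]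
    exact (even_two_mul _).add (hF l.2)
  · intro h
    rw [prod_apply, toBilin'_diagonal_one_neg_one_apply] at h
    have h' : Even (x.1 0 * x.1 0 - x.1 1 * x.1 1) := (Int.even_add.mp h).mpr (hF x.2)
    have h01 : Even (x.1 0) ↔ Even (x.1 1) := by
      have := Int.even_sub.mp h'
      simpa [Int.even_mul] using this
    obtain ⟨p, hp⟩ : Even (x.1 0 + x.1 1) := Int.even_add.mpr h01
    obtain ⟨q, hq⟩ : Even (x.1 0 - x.1 1) := Int.even_sub.mpr h01
    refine ⟨(![p, q], x.2), ?_⟩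
    simp only [LinearMap.prodMap_apply, Matrix.mulVecLin_apply, mulVec_kappa, LinearMap.id_apply,
      Matrix.cons_val_zero, Matrix.cons_val_one]
    exact Prod.ext ((vec2_eq_iff _ _ _).mpr ⟨by omega, by omega⟩) rfl

/-- **`τ(U ⊕ F) = τ(I₊ ⊕ I₋ ⊕ F)`.** Both contain (an isometric copy of) `Λ ⊕ F` with exponent
`2`, and the signature of a lattice is unchanged on a sublattice of finite exponent
(`signature_eq_of_injective_of_smul_mem_range`). Serre: `τ(U) = 0 = τ(I₊) + τ(I₋)` and `τ` is
additive (*A Course in Arithmetic*, Ch. V §1.3.7, §1.4.1–1.4.2). [cite: Serre1973, Ch. V §1.3.7, §1.4] -/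
theorem signature_hyperbolicForm_prod_eq [Module.Finite ℤ M] [Module.Free ℤ M] :
    (hyperbolicForm.prod F).signature =
      ((Matrix.toBilin' (Matrix.diagonal ![(1 : ℤ), -1])).prod F).signature := by
  haveI : NoZeroSMulDivisors ℤ ((Fin 2 → ℤ) × M) := noZeroSMulDivisors_int_of_isTorsionFree
  have h1 := signature_eq_of_injective_of_smul_mem_range
    (Q := (Matrix.toBilin' !![(0 : ℤ), 2; 2, 0]).prod F) (Q' := hyperbolicForm.prod F)
    (LinearMap.prodMap (Matrix.mulVecLin !![(2 : ℤ), 0; 0, 1]) LinearMap.id) injective_iota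
    (hyperbolicForm_prod_iota_apply F) two_ne_zero (two_smul_mem_range_iota (M := M))
  have h2 := signature_eq_of_injective_of_smul_mem_range
    (Q := (Matrix.toBilin' !![(0 : ℤ), 2; 2, 0]).prod F)
    (Q' := (Matrix.toBilin' (Matrix.diagonal ![(1 : ℤ), -1])).prod F)
    (LinearMap.prodMap (Matrix.mulVecLin !![(1 : ℤ), 1; 1, -1]) LinearMap.id) injective_kappa
    (diag_prod_kappa_apply F) two_ne_zero (two_smul_mem_range_kappa (M := M))
  rw [← h1, ← h2]

end Sublattices

/-- **Serre's Lemma 6, first half: `I₊ ⊕ I₋ ⊕ F₁ ≅ I₊ ⊕ I₋ ⊕ F₂` induces `Λ ⊕ F₁ ≅ Λ ⊕ F₂`.**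
An isometry of `Eᵢ = I₊ ⊕ I₋ ⊕ Fᵢ` (`Fᵢ` of type II, `F₁` unimodular) preserves the parity of
`x.x`, hence carries the even sublattice `E₁⁰ = κ(Λ ⊕ F₁)` onto `E₂⁰ = κ(Λ ⊕ F₂)` ("it carries
`E₁` onto `E₂`, thus also `E₁⁰` onto `E₂⁰`", Serre, *A Course in Arithmetic*, Ch. V §3.5, proof
of Lemma 6). [cite: Serre1973, Ch. V §3.5 Lemma 6] -/
theorem equivalent_twoHyperbolic_prod_of_equivalent_diag_prod {M₁ M₂ : Type*} [AddCommGroup M₁]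
    [AddCommGroup M₂] {F₁ : BilinForm ℤ M₁} {F₂ : BilinForm ℤ M₂} (hF₁ : F₁.IsEven)
    (hF₂ : F₂.IsEven) (hu₁ : F₁.IsUnimodular)
    (h : ((Matrix.toBilin' (Matrix.diagonal ![(1 : ℤ), -1])).prod F₁).Equivalent
      ((Matrix.toBilin' (Matrix.diagonal ![(1 : ℤ), -1])).prod F₂)) :
    ((Matrix.toBilin' !![(0 : ℤ), 2; 2, 0]).prod F₁).Equivalent
      ((Matrix.toBilin' !![(0 : ℤ), 2; 2, 0]).prod F₂) := by
  obtain ⟨Φ⟩ := h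
  refine equivalent_of_forall_mem_range_iff
    (LinearMap.prodMap (Matrix.mulVecLin !![(1 : ℤ), 1; 1, -1]) LinearMap.id)
    (LinearMap.prodMap (Matrix.mulVecLin !![(1 : ℤ), 1; 1, -1]) LinearMap.id)
    injective_kappa (diag_prod_kappa_apply F₁) (diag_prod_kappa_apply F₂) Φ (fun w => ?_) ?_
  · rw [mem_range_kappa_iff F₁ hF₁, mem_range_kappa_iff F₂ hF₂, Φ.map_app]
  · -- `Λ ⊕ F₁` is nondegenerate: it embeds isometrically by `κ` into the unimodular `I₊ ⊕ I₋ ⊕ F₁`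
    -- with exponent `2`
    intro l hl
    have hu : ((Matrix.toBilin' (Matrix.diagonal ![(1 : ℤ), -1])).prod F₁).IsUnimodular :=
      isUnimodular_prod_iff.mpr ⟨isUnimodular_toBilin'_diagonal_one_neg_one, hu₁⟩
    haveI : LinearMap.IsPerfPair ((Matrix.toBilin' (Matrix.diagonal ![(1 : ℤ), -1])).prod F₁) := hu
    set κ := LinearMap.prodMap (Matrix.mulVecLin !![(1 : ℤ), 1; 1, -1]) (LinearMap.id (M := M₁) (R := ℤ))
      with hκ
    have h0 : ∀ w, ((Matrix.toBilin' (Matrix.diagonal ![(1 : ℤ), -1])).prod F₁) (κ l) ((2 : ℤ) • w) = 0 :=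
      fun w => by
        obtain ⟨l', hl'⟩ := two_smul_mem_range_kappa (M := M₁) w
        rw [← hl', diag_prod_kappa_apply, hl l']
    have hκl : κ l = 0 := by
      refine (LinearMap.IsPerfPair.bijective_left
        ((Matrix.toBilin' (Matrix.diagonal ![(1 : ℤ), -1])).prod F₁)).1 ?_
      rw [map_zero]
      refine LinearMap.ext fun w => ?_
      have := h0 w
      rw [LinearMap.BilinForm.smul_right] at this
      simpa using this
    exact injective_kappa (by rw [hκl, map_zero])

end Literature.Topology.FourManifolds
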